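import Summits.Ventures.CertifiedManyBodySolver.Observables.StiffnessTLKineticCeilingURay
import Summits.Ventures.CertifiedManyBodySolver.Observables.DerivedHoppingFloorTTPrime
import HarnessLib

/-!
# Ventures/CertifiedManyBodySolver — Observables/DoccHoppingURayTTPrime.lean

HONEST FRAMING: one-sided statements about the site double occupancy and the TOTAL (nearest + next-nearest-neighbour) hopping energy of
torus-limit ground states on HALF-LINES of the coupling at ANY fixed `t′` — the transport lemmas behind «certify parameter BOXES instead of
points» (D-0042 R1b / R2(e)) for the two conjugate observables of the `t–t′–U` Hubbard energy. A docc or hopping floor is NOT a stiffness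
floor; not informative vs print; not a superconductivity verdict; zero compute; no definition, no claim node, no `sorry`.

Cell `hubbard-obs` (D-0042), seat p2 (stiffness), `prover-hubbard-obs-p2-g14-0`. The `t′ = 0` KINETIC twins are
`Observables/StiffnessTLKineticCeilingURay.lean` (p2 g8, p434970); this file adds what that file's header lists under «does NOT say»
only because it was not needed there: the SAME Griffiths / Koma–Tasaki monotonicity (`IsTorusLimitOf.docc_le_and_oneBody_le_of_groundStates`,
Literature/HubbardTTPrimeCapCutDualRows.lean, any `t, t′`) read for

* the DOUBLE OCCUPANCY `d(ω) = Re ω(n_{0↑} n_{0↓})` — NON-INCREASING in `U` across the torus-limit ground-state classes at fixed `(n, t′)`: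
  `forall_torusLimit_docc_le_of_le_coupling` (a docc CEILING certified at `U₀` holds at every `U ≥ U₀`) and
  `forall_torusLimit_le_docc_of_coupling_le` (a docc FLOOR certified at `U₀` holds at every `0 ≤ U ≤ U₀`);
* the TOTAL HOPPING energy per site `h(ω) = Σ_i(−1)Σ_σ(Re ω(c†_0c_{e_i}) + Re ω(c†_{e_i}c_0)) + Σ_s Re ω(Φ_{t′}({0, 0 + diag_s}))` (the one-body mean
  energy `e_{Φ(1,t′,0)}(ω)`, dictionary `meanEnergy_hubbardTTPrime_oneBody_eq_hoppingDensityTT'`) — `−h` NON-INCREASING in `U`: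
  `forall_torusLimit_negHoppingTT'_le_of_le_coupling` (a ceiling on `−h` at `U₀` holds at every `U ≥ U₀`) and
  `forall_torusLimit_le_negHoppingTT'_of_coupling_le` (a floor on `−h` at `U₀` holds at every `0 ≤ U ≤ U₀`).

At `t′ = 0` the hopping statements reduce to the kinetic ones of the twin file (the diagonal terms vanish). What does NOT transport at `t′ ≠ 0`:
the f-sum STIFFNESS functional `−¼(K₁ + 2t′K₂)` (it is not the hopping energy `K₁ + t′K₂`; STIFFNESS-LINE §5), the `K₂` amplitude alone, anything
along `n` or `t′`.
References: [Griffiths1966] §II and [KomaTasaki1994] §1 (monotonicity of conjugate observables of energy minimisers); [BratteliRobinsonII1997] §6.2.4.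
-/

noncomputable section

namespace Summit.Ventures.CertifiedManyBodySolver.Observables

open Literature.MathematicalPhysics.QuantumLattice
open Literature.MathematicalPhysics.QuantumLattice.ThermodynamicLimit
open Literature.Probability.LatticeModels
open Matrix Finset Filter Topology
open scoped Matrix BigOperators ComplexOrder

/-! ## §1 Double occupancy along the `U`-ray (any `t′`) -/

/-- **A certified docc CEILING transports UP the `U`-ray** (`0 ≤ U₀ ≤ U`, `0 ≤ n < 2`, any `t′`): if `Re ω(n_{0↑}n_{0↓}) ≤ D` for every torus
limit `ω` of unit `(rectN n L, S^z = 0)`-sector ground states of `hubbardTorusTT' L 1 tp U₀`, then the same holds for every such torus limit at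
coupling `U` (the double occupancy is non-increasing in `U` across the torus-limit ground-state classes:
`IsTorusLimitOf.docc_le_and_oneBody_le_of_groundStates` against an inhabitant of the class at `U₀`). [cite: Griffiths1966, §II] [cite: KomaTasaki1994, §1] -/
theorem forall_torusLimit_docc_le_of_le_coupling (tp : ℝ) {U₀ U : ℝ} (hU₀ : 0 ≤ U₀) (hU : U₀ ≤ U) {n : ℝ} (hn0 : 0 ≤ n) (hn2 : n < 2)
    {D : ℝ}
    (hD : ∀ (ω : InfVolFermionState 2) (Ls : ℕ → ℕ) (ψ : ∀ L, Fock (Orb (FermionTorus 2 L))),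
      Tendsto Ls atTop atTop →
      (∀ j, IsGroundStateInSector (hubbardTorusTT' (Ls j) 1 tp U₀) (rectN n (Ls j)) 0 (ψ (Ls j))) →
      (∀ j, star (ψ (Ls j)) ⬝ᵥ ψ (Ls j) = 1) → ω.IsTorusLimitOf ψ Ls →
      (ω.expect ({0} : Finset (Site 2)) (doccAt0 2)).re ≤ D) :
    ∀ (ω : InfVolFermionState 2) (Ls : ℕ → ℕ) (ψ : ∀ L, Fock (Orb (FermionTorus 2 L))),
      Tendsto Ls atTop atTop →
      (∀ j, IsGroundStateInSector (hubbardTorusTT' (Ls j) 1 tp U) (rectN n (Ls j)) 0 (ψ (Ls j))) →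
      (∀ j, star (ψ (Ls j)) ⬝ᵥ ψ (Ls j) = 1) → ω.IsTorusLimitOf ψ Ls →
      (ω.expect ({0} : Finset (Site 2)) (doccAt0 2)).re ≤ D := by
  intro ω Ls ψ hLs hψ hψ1 hω
  rcases eq_or_lt_of_le hU with rfl | hlt
  · exact hD ω Ls ψ hLs hψ hψ1 hω
  · obtain ⟨ψA, φ, ωA, hφ, hψA, hψA1, hωA, -, -, -⟩ :=
      exists_isTorusLimitOf_sectorGroundState_TT' 1 tp U₀ hn0 hn2.le (Ls := id) tendsto_id
    have hLφ : Tendsto (id ∘ φ : ℕ → ℕ) atTop atTop := tendsto_id.comp hφ.tendsto_atTop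
    have hmono := (InfVolFermionState.IsTorusLimitOf.docc_le_and_oneBody_le_of_groundStates 1 tp hU₀ hlt hn0 hn2 hωA hLφ
      (fun j => hψA _) (fun j => hψA1 _) hω hLs hψ hψ1).1
    have hA := hD ωA (id ∘ φ) ψA hLφ (fun j => hψA _) (fun j => hψA1 _) hωA
    have hd : (ω.expect ({0} : Finset (Site 2)) (doccAt0 2)).re =
        (ω.expect {0} (nAt 0 (mem_singleton_self 0) 0 * nAt 0 (mem_singleton_self 0) 1)).re := rfl
    have hdA : (ωA.expect ({0} : Finset (Site 2)) (doccAt0 2)).re =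
        (ωA.expect {0} (nAt 0 (mem_singleton_self 0) 0 * nAt 0 (mem_singleton_self 0) 1)).re := rfl
    rw [hd]; rw [hdA] at hA
    exact hmono.trans hA

/-- **A certified docc FLOOR transports DOWN the `U`-ray** (`0 ≤ U ≤ U₀`, `0 ≤ n < 2`, any `t′`): if `D ≤ Re ω(n_{0↑}n_{0↓})` for every torus
limit of unit `(rectN n L, S^z = 0)`-sector ground states at `U₀`, then the same holds for every such torus limit at `U`.
[cite: Griffiths1966, §II] [cite: KomaTasaki1994, §1] -/
theorem forall_torusLimit_le_docc_of_coupling_le (tp : ℝ) {U₀ U : ℝ} (hU0 : 0 ≤ U) (hU : U ≤ U₀) {n : ℝ} (hn0 : 0 ≤ n) (hn2 : n < 2)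
    {D : ℝ}
    (hD : ∀ (ω : InfVolFermionState 2) (Ls : ℕ → ℕ) (ψ : ∀ L, Fock (Orb (FermionTorus 2 L))),
      Tendsto Ls atTop atTop →
      (∀ j, IsGroundStateInSector (hubbardTorusTT' (Ls j) 1 tp U₀) (rectN n (Ls j)) 0 (ψ (Ls j))) →
      (∀ j, star (ψ (Ls j)) ⬝ᵥ ψ (Ls j) = 1) → ω.IsTorusLimitOf ψ Ls →
      D ≤ (ω.expect ({0} : Finset (Site 2)) (doccAt0 2)).re) :
    ∀ (ω : InfVolFermionState 2) (Ls : ℕ → ℕ) (ψ : ∀ L, Fock (Orb (FermionTorus 2 L))),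
      Tendsto Ls atTop atTop →
      (∀ j, IsGroundStateInSector (hubbardTorusTT' (Ls j) 1 tp U) (rectN n (Ls j)) 0 (ψ (Ls j))) →
      (∀ j, star (ψ (Ls j)) ⬝ᵥ ψ (Ls j) = 1) → ω.IsTorusLimitOf ψ Ls →
      D ≤ (ω.expect ({0} : Finset (Site 2)) (doccAt0 2)).re := by
  intro ω Ls ψ hLs hψ hψ1 hω
  rcases eq_or_lt_of_le hU with rfl | hlt
  · exact hD ω Ls ψ hLs hψ hψ1 hω
  · obtain ⟨ψP, φ, ωP, hφ, hψP, hψP1, hωP, -, -, -⟩ :=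
      exists_isTorusLimitOf_sectorGroundState_TT' 1 tp U₀ hn0 hn2.le (Ls := id) tendsto_id
    have hLφ : Tendsto (id ∘ φ : ℕ → ℕ) atTop atTop := tendsto_id.comp hφ.tendsto_atTop
    have hmono := (InfVolFermionState.IsTorusLimitOf.docc_le_and_oneBody_le_of_groundStates 1 tp hU0 hlt hn0 hn2 hω hLs hψ hψ1
      hωP hLφ (fun j => hψP _) (fun j => hψP1 _)).1
    have hP := hD ωP (id ∘ φ) ψP hLφ (fun j => hψP _) (fun j => hψP1 _) hωP
    have hd : (ω.expect ({0} : Finset (Site 2)) (doccAt0 2)).re =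
        (ω.expect {0} (nAt 0 (mem_singleton_self 0) 0 * nAt 0 (mem_singleton_self 0) 1)).re := rfl
    have hdP : (ωP.expect ({0} : Finset (Site 2)) (doccAt0 2)).re =
        (ωP.expect {0} (nAt 0 (mem_singleton_self 0) 0 * nAt 0 (mem_singleton_self 0) 1)).re := rfl
    rw [hd]; rw [hdP] at hP
    exact hP.trans hmono

/-! ## §2 The total (`t–t′`) hopping energy along the `U`-ray -/

/-- DICTIONARY (any `t′`): for a translation-invariant state `ω` on `ℤ²`, the one-body mean energy `e_{Φ(1,t′,0)}(ω)` is the TOTAL hopping energy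
per site — nearest-neighbour bond form plus the two diagonal `t′` terms. (`t′ = 0`: `meanEnergy_hubbardTTPrime_oneBody_eq_kineticDensity`.)
[cite: BratteliRobinsonII1997, §6.2.4] -/
theorem meanEnergy_hubbardTTPrime_oneBody_eq_hoppingDensityTT' (tp : ℝ) {ω : InfVolFermionState 2} (hω : ω.IsTranslationInvariant) :
    ω.meanEnergy (hubbardTTPrimeFermionInteraction 1 tp 0) 1 =
      (∑ i : Fin 2, -(1 : ℝ) * ∑ σ : Fin 2,
        ((ω.expect {0, 0 + unitVec i}
            ((cAt 0 (mem_insert_self _ _) σ)ᴴ * cAt (0 + unitVec i) (mem_insert_of_mem (mem_singleton_self _)) σ)).re +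
          (ω.expect {0, 0 + unitVec i}
            ((cAt (0 + unitVec i) (mem_insert_of_mem (mem_singleton_self _)) σ)ᴴ * cAt 0 (mem_insert_self _ _) σ)).re)) +
      ∑ s : Fin 2, (ω.expect {0, 0 + diagVec s} ((diagHoppingFermionInteraction tp).Φ {0, 0 + diagVec s})).re := by
  rw [hω.meanEnergy_hubbardTTPrime_eq (t' := tp) 1 0, hω.hubbardEnergyDensity_eq_docc_add_hopping 1 0]
  ring

/-- **A certified ceiling on the total hopping `−h` transports UP the `U`-ray** (`0 ≤ U₀ ≤ U`, `0 ≤ n < 2`, any `t′`): if `−h(ω) ≤ X` for every torus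
limit `ω` of unit `(rectN n L, S^z = 0)`-sector ground states of `hubbardTorusTT' L 1 tp U₀`, then `−h(ω′) ≤ X` for every such torus limit at `U`
(the one-body energy is non-decreasing in `U` across the classes). [cite: Griffiths1966, §II] [cite: KomaTasaki1994, §1] -/
theorem forall_torusLimit_negHoppingTT'_le_of_le_coupling (tp : ℝ) {U₀ U : ℝ} (hU₀ : 0 ≤ U₀) (hU : U₀ ≤ U) {n : ℝ} (hn0 : 0 ≤ n)
    (hn2 : n < 2) {X : ℝ}
    (hX : ∀ (ω : InfVolFermionState 2) (Ls : ℕ → ℕ) (ψ : ∀ L, Fock (Orb (FermionTorus 2 L))),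
      Tendsto Ls atTop atTop →
      (∀ j, IsGroundStateInSector (hubbardTorusTT' (Ls j) 1 tp U₀) (rectN n (Ls j)) 0 (ψ (Ls j))) →
      (∀ j, star (ψ (Ls j)) ⬝ᵥ ψ (Ls j) = 1) → ω.IsTorusLimitOf ψ Ls →
      -((∑ i : Fin 2, -(1 : ℝ) * ∑ σ : Fin 2,
          ((ω.expect {0, 0 + unitVec i}
              ((cAt 0 (mem_insert_self _ _) σ)ᴴ * cAt (0 + unitVec i) (mem_insert_of_mem (mem_singleton_self _)) σ)).re +
            (ω.expect {0, 0 + unitVec i}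
              ((cAt (0 + unitVec i) (mem_insert_of_mem (mem_singleton_self _)) σ)ᴴ * cAt 0 (mem_insert_self _ _) σ)).re)) +
        ∑ s : Fin 2, (ω.expect {0, 0 + diagVec s} ((diagHoppingFermionInteraction tp).Φ {0, 0 + diagVec s})).re) ≤ X) :
    ∀ (ω : InfVolFermionState 2) (Ls : ℕ → ℕ) (ψ : ∀ L, Fock (Orb (FermionTorus 2 L))),
      Tendsto Ls atTop atTop →
      (∀ j, IsGroundStateInSector (hubbardTorusTT' (Ls j) 1 tp U) (rectN n (Ls j)) 0 (ψ (Ls j))) →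
      (∀ j, star (ψ (Ls j)) ⬝ᵥ ψ (Ls j) = 1) → ω.IsTorusLimitOf ψ Ls →
      -((∑ i : Fin 2, -(1 : ℝ) * ∑ σ : Fin 2,
          ((ω.expect {0, 0 + unitVec i}
              ((cAt 0 (mem_insert_self _ _) σ)ᴴ * cAt (0 + unitVec i) (mem_insert_of_mem (mem_singleton_self _)) σ)).re +
            (ω.expect {0, 0 + unitVec i}
              ((cAt (0 + unitVec i) (mem_insert_of_mem (mem_singleton_self _)) σ)ᴴ * cAt 0 (mem_insert_self _ _) σ)).re)) +
        ∑ s : Fin 2, (ω.expect {0, 0 + diagVec s} ((diagHoppingFermionInteraction tp).Φ {0, 0 + diagVec s})).re) ≤ X := by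
  intro ω Ls ψ hLs hψ hψ1 hω
  rcases eq_or_lt_of_le hU with rfl | hlt
  · exact hX ω Ls ψ hLs hψ hψ1 hω
  · obtain ⟨ψA, φ, ωA, hφ, hψA, hψA1, hωA, -, -, -⟩ :=
      exists_isTorusLimitOf_sectorGroundState_TT' 1 tp U₀ hn0 hn2.le (Ls := id) tendsto_id
    have hLφ : Tendsto (id ∘ φ : ℕ → ℕ) atTop atTop := tendsto_id.comp hφ.tendsto_atTop
    have hmono := (InfVolFermionState.IsTorusLimitOf.docc_le_and_oneBody_le_of_groundStates 1 tp hU₀ hlt hn0 hn2 hωA hLφ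
      (fun j => hψA _) (fun j => hψA1 _) hω hLs hψ hψ1).2
    rw [meanEnergy_hubbardTTPrime_oneBody_eq_hoppingDensityTT' tp hωA.isTranslationInvariant,
      meanEnergy_hubbardTTPrime_oneBody_eq_hoppingDensityTT' tp hω.isTranslationInvariant] at hmono
    have hA := hX ωA (id ∘ φ) ψA hLφ (fun j => hψA _) (fun j => hψA1 _) hωA
    linarith

/-- **A certified floor on the total hopping `−h` transports DOWN the `U`-ray** (`0 ≤ U ≤ U₀`, `0 ≤ n < 2`, any `t′`): if `K ≤ −h(ω)` for every torus
limit of unit `(rectN n L, S^z = 0)`-sector ground states at `U₀`, then `K ≤ −h(ω′)` for every such torus limit at `U`.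
[cite: Griffiths1966, §II] [cite: KomaTasaki1994, §1] -/
theorem forall_torusLimit_le_negHoppingTT'_of_coupling_le (tp : ℝ) {U₀ U : ℝ} (hU0 : 0 ≤ U) (hU : U ≤ U₀) {n : ℝ} (hn0 : 0 ≤ n)
    (hn2 : n < 2) {K : ℝ}
    (hK : ∀ (ω : InfVolFermionState 2) (Ls : ℕ → ℕ) (ψ : ∀ L, Fock (Orb (FermionTorus 2 L))),
      Tendsto Ls atTop atTop →
      (∀ j, IsGroundStateInSector (hubbardTorusTT' (Ls j) 1 tp U₀) (rectN n (Ls j)) 0 (ψ (Ls j))) →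
      (∀ j, star (ψ (Ls j)) ⬝ᵥ ψ (Ls j) = 1) → ω.IsTorusLimitOf ψ Ls →
      K ≤ -((∑ i : Fin 2, -(1 : ℝ) * ∑ σ : Fin 2,
          ((ω.expect {0, 0 + unitVec i}
              ((cAt 0 (mem_insert_self _ _) σ)ᴴ * cAt (0 + unitVec i) (mem_insert_of_mem (mem_singleton_self _)) σ)).re +
            (ω.expect {0, 0 + unitVec i}
              ((cAt (0 + unitVec i) (mem_insert_of_mem (mem_singleton_self _)) σ)ᴴ * cAt 0 (mem_insert_self _ _) σ)).re)) +
        ∑ s : Fin 2, (ω.expect {0, 0 + diagVec s} ((diagHoppingFermionInteraction tp).Φ {0, 0 + diagVec s})).re)) :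
    ∀ (ω : InfVolFermionState 2) (Ls : ℕ → ℕ) (ψ : ∀ L, Fock (Orb (FermionTorus 2 L))),
      Tendsto Ls atTop atTop →
      (∀ j, IsGroundStateInSector (hubbardTorusTT' (Ls j) 1 tp U) (rectN n (Ls j)) 0 (ψ (Ls j))) →
      (∀ j, star (ψ (Ls j)) ⬝ᵥ ψ (Ls j) = 1) → ω.IsTorusLimitOf ψ Ls →
      K ≤ -((∑ i : Fin 2, -(1 : ℝ) * ∑ σ : Fin 2,
          ((ω.expect {0, 0 + unitVec i}
              ((cAt 0 (mem_insert_self _ _) σ)ᴴ * cAt (0 + unitVec i) (mem_insert_of_mem (mem_singleton_self _)) σ)).re +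
            (ω.expect {0, 0 + unitVec i}
              ((cAt (0 + unitVec i) (mem_insert_of_mem (mem_singleton_self _)) σ)ᴴ * cAt 0 (mem_insert_self _ _) σ)).re)) +
        ∑ s : Fin 2, (ω.expect {0, 0 + diagVec s} ((diagHoppingFermionInteraction tp).Φ {0, 0 + diagVec s})).re) := by
  intro ω Ls ψ hLs hψ hψ1 hω
  rcases eq_or_lt_of_le hU with rfl | hlt
  · exact hK ω Ls ψ hLs hψ hψ1 hω
  · obtain ⟨ψP, φ, ωP, hφ, hψP, hψP1, hωP, -, -, -⟩ :=
      exists_isTorusLimitOf_sectorGroundState_TT' 1 tp U₀ hn0 hn2.le (Ls := id) tendsto_id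
    have hLφ : Tendsto (id ∘ φ : ℕ → ℕ) atTop atTop := tendsto_id.comp hφ.tendsto_atTop
    have hmono := (InfVolFermionState.IsTorusLimitOf.docc_le_and_oneBody_le_of_groundStates 1 tp hU0 hlt hn0 hn2 hω hLs hψ hψ1
      hωP hLφ (fun j => hψP _) (fun j => hψP1 _)).2
    rw [meanEnergy_hubbardTTPrime_oneBody_eq_hoppingDensityTT' tp hω.isTranslationInvariant,
      meanEnergy_hubbardTTPrime_oneBody_eq_hoppingDensityTT' tp hωP.isTranslationInvariant] at hmono
    have hP := hK ωP (id ∘ φ) ψP hLφ (fun j => hψP _) (fun j => hψP1 _) hωP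
    linarith

end Summit.Ventures.CertifiedManyBodySolver.Observables

end
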